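/-
# LINE (V) `valuative_door` — the trivial SECTOR ROWS of the general valuative census

For a lacunary pencil `P = Σ_l X^{d_l} M_l` of `m × m` letters over a valued field, the number of Newton-polygon
edges of `det P` (the line file's `npEdges v f = domCount v f − 1`, written out below: `domCount` is the number of
DOMINANT exponents) is at most `#support (det P) − 1`.  This settles the four trivial rows of the table `v(m, K)`
for GENERAL letters (`GenValRootLawAt` of `Cruxes/WeakLifting/Lines/valuative_door.lean`, unfolded), hence for
symmetric letters (`valRootLawAt_of_gen` there):

* ONE LETTER (`K = 1`): `det (X^{d} M) = det M · X^{m d}` is a monomial — `0` edges (`GenValRootLawAt m 1 0`);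
* TWO LETTERS (`K = 2`): `det (X^{a} A + X^{a+k} B) = X^{m a} · expand_k (det (X B + A))` has at most `m + 1`
  monomials — `≤ m` edges (`GenValRootLawAt m 2 m`; sharp already for diagonal letters `Π_i (1 + b_i X^k)` with
  distinct `v (b_i)`);
* WIDTH ONE (`m = 1`): `Σ_l s_l X^{d_l}` has at most `K` monomials — `≤ K − 1` edges (`GenValRootLawAt 1 K (K − 1)`);
* WIDTH TWO (`m = 2`): `det P` is supported on the pair sums `d_l + d_{l'}` — `≤ K (K + 1) / 2 − 1` edges
  (`GenValRootLawAt 2 K (K * (K + 1) / 2 - 1)`); for SYMMETRIC letters and `K = 4` the true value is `8`, not `9`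
  (`…ValuativeDoorTwoFourCalibration`).

No line-file constant is imported: every row is stated unfolded, binder for binder as in `GenValRootLawAt`.
Namespace `…Theorems.KPlusLogSqLaw.ValDoor`; helper file for crux `WeakLifting` (stmt-19561), LINE (V).
-/
import Mathlib

set_option linter.dupNamespace false
set_option autoImplicit false

namespace Summit.ValiantsHypothesis.ValiantsHypothesis.Theorems.KPlusLogSqLaw.ValDoor

open Polynomial Finset Matrix
open scoped BigOperators Classical

variable {F : Type*} [Field F]

/-! ## §0 Dominant exponents are monomials -/

/-- `domCount v f ≤ #support f` (unfolded): a dominant exponent is in particular a monomial of `f`. [bookkeeping] -/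
theorem card_filter_dominant_le_card_support (v : AbsoluteValue F ℝ) (f : F[X]) :
    (f.support.filter fun E => ∃ r : ℝ, 0 < r ∧ ∀ E' ∈ f.support, E' ≠ E →
      v (f.coeff E') * r ^ E' < v (f.coeff E) * r ^ E).card ≤ f.support.card :=
  Finset.card_filter_le _ _

/-! ## §1 One letter: `v(m, 1) = 0` -/

/-- `det (Σ_{l : Fin 1} X^{d_l} M_l) = det M_0 · X^{m d_0}`. [bookkeeping: `Matrix.det_smul`] -/
theorem det_one_letter (m : ℕ) (d : Fin 1 → ℕ) (M : Fin 1 → Matrix (Fin m) (Fin m) F) :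
    Matrix.det (∑ l, ((X : F[X]) ^ d l) • (M l).map (C : F →+* F[X]))
      = C (Matrix.det (M 0)) * X ^ (m * d 0) := by
  rw [Fin.sum_univ_one, Matrix.det_smul, Fintype.card_fin, ← RingHom.mapMatrix_apply, ← RingHom.map_det]
  ring

/-- **ONE-LETTER ROW** `GenValRootLawAt m 1 0` (unfolded): a one-letter pencil determinant is a monomial, so its
Newton polygon has no edge. [sector row; sharp trivially] -/
theorem genValRootLaw_one_letter_unfolded (m : ℕ) :
    ∀ (F : Type) [Field F] [CharZero F] (v : AbsoluteValue F ℝ), IsNonarchimedean v →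
      ∀ (d : Fin 1 → ℕ) (M : Fin 1 → Matrix (Fin m) (Fin m) F),
        ((Matrix.det (∑ l, ((Polynomial.X : Polynomial F) ^ d l) • (M l).map Polynomial.C)).support.filter fun E =>
            ∃ r : ℝ, 0 < r ∧ ∀ E' ∈ (Matrix.det (∑ l, ((Polynomial.X : Polynomial F) ^ d l) • (M l).map Polynomial.C)).support,
              E' ≠ E →
              v ((Matrix.det (∑ l, ((Polynomial.X : Polynomial F) ^ d l) • (M l).map Polynomial.C)).coeff E') * r ^ E'
                < v ((Matrix.det (∑ l, ((Polynomial.X : Polynomial F) ^ d l) • (M l).map Polynomial.C)).coeff E) * r ^ E).card - 1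
          ≤ 0 := by
  intro F _ _ v _ d M
  set f : F[X] := Matrix.det (∑ l, ((X : F[X]) ^ d l) • (M l).map (C : F →+* F[X])) with hf
  have h := card_filter_dominant_le_card_support v f
  have h1 : f.support.card ≤ 1 := by
    rw [hf, det_one_letter]
    exact card_support_C_mul_X_pow_le_one
  omega

/-! ## §2 Two letters: `v(m, 2) ≤ m` -/

/-- `expand_k` maps the linear pencil `X B + A` to the lacunary one `X^k B + A`, entrywise. [bookkeeping] -/
theorem map_expand_X_smul_add {m : ℕ} (k : ℕ) (A B : Matrix (Fin m) (Fin m) F) :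
    ((X : F[X]) • B.map (C : F →+* F[X]) + A.map (C : F →+* F[X])).map (expand F k)
      = ((X : F[X]) ^ k) • B.map (C : F →+* F[X]) + A.map (C : F →+* F[X]) := by
  ext i j
  simp only [Matrix.map_apply, Matrix.add_apply, Matrix.smul_apply, smul_eq_mul, map_add, map_mul, expand_X,
    expand_C]

/-- `det (X^{a} A + X^{a+k} B) = X^{m a} · expand_k (det (X B + A))`. [bookkeeping] -/
theorem det_two_letters (m a k : ℕ) (A B : Matrix (Fin m) (Fin m) F) :
    Matrix.det (((X : F[X]) ^ a) • A.map (C : F →+* F[X]) + ((X : F[X]) ^ (a + k)) • B.map (C : F →+* F[X]))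
      = X ^ (m * a) * expand F k (Matrix.det ((X : F[X]) • B.map (C : F →+* F[X]) + A.map (C : F →+* F[X]))) := by
  have hmat : ((X : F[X]) ^ a) • A.map (C : F →+* F[X]) + ((X : F[X]) ^ (a + k)) • B.map (C : F →+* F[X])
      = ((X : F[X]) ^ a) • (((X : F[X]) ^ k) • B.map (C : F →+* F[X]) + A.map (C : F →+* F[X])) := by
    rw [smul_add, smul_smul, ← pow_add]
    exact add_comm _ _
  rw [hmat, Matrix.det_smul, Fintype.card_fin, ← pow_mul, Nat.mul_comm, AlgHom.map_det, AlgHom.mapMatrix_apply,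
    map_expand_X_smul_add]

/-- the determinant of a two-letter pencil has at most `m + 1` monomials. [sector count] -/
theorem card_support_det_two_letters (m a k : ℕ) (A B : Matrix (Fin m) (Fin m) F) :
    (Matrix.det (((X : F[X]) ^ a) • A.map (C : F →+* F[X]) + ((X : F[X]) ^ (a + k)) • B.map (C : F →+* F[X]))).support.card
      ≤ m + 1 := by
  rw [det_two_letters]
  set g : F[X] := Matrix.det ((X : F[X]) • B.map (C : F →+* F[X]) + A.map (C : F →+* F[X])) with hg
  have hdeg : g.natDegree ≤ m := by
    have h := Polynomial.natDegree_det_X_add_C_le B A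
    rwa [Fintype.card_fin] at h
  rcases Nat.eq_zero_or_pos k with hk | hk
  · subst hk
    rw [expand_zero, mul_comm]
    exact card_support_C_mul_X_pow_le_one.trans (by omega)
  · have hsub : (X ^ (m * a) * expand F k g).support ⊆ (Finset.range (m + 1)).image (fun j => m * a + k * j) := by
      intro n hn
      rw [mem_support_iff, coeff_X_pow_mul'] at hn
      split_ifs at hn with hle
      · rw [coeff_expand hk] at hn
        split_ifs at hn with hdvd
        · obtain ⟨j, hj⟩ := hdvd
          have hjdeg : j ≤ g.natDegree := by
            by_contra hlt
            apply hn
            rw [hj, Nat.mul_div_cancel_left j hk]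
            exact coeff_eq_zero_of_natDegree_lt (by omega)
          exact Finset.mem_image.2 ⟨j, Finset.mem_range.2 (by omega), by omega⟩
        · exact absurd rfl hn
      · exact absurd rfl hn
    calc (X ^ (m * a) * expand F k g).support.card
        ≤ ((Finset.range (m + 1)).image (fun j => m * a + k * j)).card := Finset.card_le_card hsub
      _ ≤ (Finset.range (m + 1)).card := Finset.card_image_le
      _ = m + 1 := Finset.card_range _

/-- **TWO-LETTER ROW** `GenValRootLawAt m 2 m` (unfolded): a two-letter `m × m` pencil determinant has at most `m + 1`
monomials, hence at most `m` Newton edges. [sector row; sharp: diagonal letters `Π_i (1 + b_i X^k)` with distinct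
`v (b_i)`] -/
theorem genValRootLaw_two_letters_unfolded (m : ℕ) :
    ∀ (F : Type) [Field F] [CharZero F] (v : AbsoluteValue F ℝ), IsNonarchimedean v →
      ∀ (d : Fin 2 → ℕ) (M : Fin 2 → Matrix (Fin m) (Fin m) F),
        ((Matrix.det (∑ l, ((Polynomial.X : Polynomial F) ^ d l) • (M l).map Polynomial.C)).support.filter fun E =>
            ∃ r : ℝ, 0 < r ∧ ∀ E' ∈ (Matrix.det (∑ l, ((Polynomial.X : Polynomial F) ^ d l) • (M l).map Polynomial.C)).support,
              E' ≠ E →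
              v ((Matrix.det (∑ l, ((Polynomial.X : Polynomial F) ^ d l) • (M l).map Polynomial.C)).coeff E') * r ^ E'
                < v ((Matrix.det (∑ l, ((Polynomial.X : Polynomial F) ^ d l) • (M l).map Polynomial.C)).coeff E) * r ^ E).card - 1
          ≤ m := by
  intro F _ _ v _ d M
  set f : F[X] := Matrix.det (∑ l, ((X : F[X]) ^ d l) • (M l).map (C : F →+* F[X])) with hf
  have h := card_filter_dominant_le_card_support v f
  have h1 : f.support.card ≤ m + 1 := by
    rw [hf, Fin.sum_univ_two]
    rcases le_total (d 0) (d 1) with hle | hle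
    · obtain ⟨k, hk⟩ := Nat.exists_eq_add_of_le hle
      rw [hk]
      exact card_support_det_two_letters m (d 0) k (M 0) (M 1)
    · obtain ⟨k, hk⟩ := Nat.exists_eq_add_of_le hle
      rw [hk, add_comm]
      exact card_support_det_two_letters m (d 1) k (M 1) (M 0)
  omega

/-! ## §3 Width one: `v(1, K) ≤ K − 1` -/

/-- `det` of a `1 × 1` lacunary pencil is the lacunary polynomial `Σ_l s_l X^{d_l}`. [bookkeeping] -/
theorem det_width_one {K : ℕ} (d : Fin K → ℕ) (M : Fin K → Matrix (Fin 1) (Fin 1) F) :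
    Matrix.det (∑ l, ((X : F[X]) ^ d l) • (M l).map (C : F →+* F[X])) = ∑ l, C (M l 0 0) * X ^ d l := by
  rw [Matrix.det_fin_one, Matrix.sum_apply]
  refine Finset.sum_congr rfl fun l _ => ?_
  rw [Matrix.smul_apply, Matrix.map_apply, smul_eq_mul, mul_comm]

/-- a `1 × 1` pencil determinant with `K` letters has at most `K` monomials. [sector count] -/
theorem card_support_det_width_one {K : ℕ} (d : Fin K → ℕ) (M : Fin K → Matrix (Fin 1) (Fin 1) F) :
    (Matrix.det (∑ l, ((X : F[X]) ^ d l) • (M l).map (C : F →+* F[X]))).support.card ≤ K := by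
  rw [det_width_one]
  have hsub : (∑ l, C (M l 0 0) * X ^ d l).support ⊆ (univ : Finset (Fin K)).image d := by
    intro n hn
    rw [mem_support_iff, finsetSum_coeff] at hn
    by_contra hnot
    apply hn
    refine Finset.sum_eq_zero fun l _ => ?_
    rw [coeff_C_mul_X_pow]
    have hne : n ≠ d l := fun h => hnot (Finset.mem_image.2 ⟨l, Finset.mem_univ _, h.symm⟩)
    rw [if_neg hne]
  calc (∑ l, C (M l 0 0) * X ^ d l).support.card
      ≤ ((univ : Finset (Fin K)).image d).card := Finset.card_le_card hsub
    _ ≤ (univ : Finset (Fin K)).card := Finset.card_image_le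
    _ = K := by rw [Finset.card_univ, Fintype.card_fin]

/-- **WIDTH-ONE ROW** `GenValRootLawAt 1 K (K − 1)` (unfolded): a lacunary polynomial with `K` terms has at most
`K − 1` Newton edges (the valuative Descartes rule; sharp: `v (s_l)` strictly concave in `l`). [sector row] -/
theorem genValRootLaw_width_one_unfolded (K : ℕ) :
    ∀ (F : Type) [Field F] [CharZero F] (v : AbsoluteValue F ℝ), IsNonarchimedean v →
      ∀ (d : Fin K → ℕ) (M : Fin K → Matrix (Fin 1) (Fin 1) F),
        ((Matrix.det (∑ l, ((Polynomial.X : Polynomial F) ^ d l) • (M l).map Polynomial.C)).support.filter fun E =>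
            ∃ r : ℝ, 0 < r ∧ ∀ E' ∈ (Matrix.det (∑ l, ((Polynomial.X : Polynomial F) ^ d l) • (M l).map Polynomial.C)).support,
              E' ≠ E →
              v ((Matrix.det (∑ l, ((Polynomial.X : Polynomial F) ^ d l) • (M l).map Polynomial.C)).coeff E') * r ^ E'
                < v ((Matrix.det (∑ l, ((Polynomial.X : Polynomial F) ^ d l) • (M l).map Polynomial.C)).coeff E) * r ^ E).card - 1
          ≤ K - 1 := by
  intro F _ _ v _ d M
  set f : F[X] := Matrix.det (∑ l, ((X : F[X]) ^ d l) • (M l).map (C : F →+* F[X])) with hf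
  have h := card_filter_dominant_le_card_support v f
  have h1 : f.support.card ≤ K := by
    rw [hf]
    exact card_support_det_width_one d M
  omega

/-! ## §4 Width two: `v(2, K) ≤ K (K + 1) / 2 − 1` -/

/-- `det Σ_l X^{d_l} M_l = Σ_{l,l'} (a_l δ_{l'} − b_l γ_{l'}) X^{d_l + d_{l'}}` for GENERAL `2 × 2` letters
`M_l = !![a_l, b_l; γ_l, δ_l]`. [bookkeeping: `Matrix.det_fin_two`; the symmetric case is `det_symmPencil_two`] -/
theorem det_pencil_two {K : ℕ} (d : Fin K → ℕ) (M : Fin K → Matrix (Fin 2) (Fin 2) F) :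
    Matrix.det (∑ l, ((X : F[X]) ^ d l) • (M l).map (C : F →+* F[X]))
      = ∑ p : Fin K × Fin K, C (M p.1 0 0 * M p.2 1 1 - M p.1 0 1 * M p.2 1 0) * X ^ (d p.1 + d p.2) := by
  have hentry : ∀ i j : Fin 2, (∑ l, ((X : F[X]) ^ d l) • (M l).map (C : F →+* F[X])) i j = ∑ l, C (M l i j) * X ^ d l := by
    intro i j
    rw [Matrix.sum_apply]
    refine Finset.sum_congr rfl fun l _ => ?_
    rw [Matrix.smul_apply, Matrix.map_apply, smul_eq_mul, mul_comm]
  rw [Matrix.det_fin_two, hentry, hentry, hentry, hentry, Finset.sum_mul_sum, Finset.sum_mul_sum,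
    ← Finset.sum_sub_distrib, Fintype.sum_prod_type]
  refine Finset.sum_congr rfl fun x _ => ?_
  rw [← Finset.sum_sub_distrib]
  refine Finset.sum_congr rfl fun y _ => ?_
  rw [map_sub, map_mul, map_mul, pow_add]
  ring

/-- a `2 × 2` pencil determinant with `K` letters is supported on the `≤ K (K + 1) / 2` pair sums. [sector count] -/
theorem card_support_det_width_two {K : ℕ} (d : Fin K → ℕ) (M : Fin K → Matrix (Fin 2) (Fin 2) F) :
    (Matrix.det (∑ l, ((X : F[X]) ^ d l) • (M l).map (C : F →+* F[X]))).support.card ≤ K * (K + 1) / 2 := by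
  set Pairs : Finset (Sym2 (Fin K)) := (univ : Finset (Fin K)).sym2 with hPairs
  set psum : Sym2 (Fin K) → ℕ := Sym2.lift ⟨fun i j => d i + d j, fun i j => Nat.add_comm _ _⟩ with hpsum
  have hpsum_mk : ∀ i j, psum s(i, j) = d i + d j := fun i j => by rw [hpsum, Sym2.lift_mk]
  have hpairs : Pairs.card = K * (K + 1) / 2 := by
    rw [hPairs, Finset.card_sym2, Finset.card_univ, Fintype.card_fin, Nat.choose_two_right, Nat.add_sub_cancel, Nat.mul_comm]
  have hsub : (Matrix.det (∑ l, ((X : F[X]) ^ d l) • (M l).map (C : F →+* F[X]))).support ⊆ Pairs.image psum := by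
    intro E hE
    have hne := Polynomial.mem_support_iff.1 hE
    rw [det_pencil_two d M, Polynomial.finsetSum_coeff] at hne
    obtain ⟨p, -, hp⟩ := Finset.exists_ne_zero_of_sum_ne_zero hne
    rw [Polynomial.coeff_C_mul_X_pow] at hp
    have hpE : E = d p.1 + d p.2 := by
      by_contra h
      exact hp (if_neg h)
    exact Finset.mem_image.2 ⟨s(p.1, p.2), Finset.mk_mem_sym2_iff.2 ⟨Finset.mem_univ _, Finset.mem_univ _⟩,
      by rw [hpsum_mk, hpE]⟩
  calc (Matrix.det (∑ l, ((X : F[X]) ^ d l) • (M l).map (C : F →+* F[X]))).support.card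
      ≤ (Pairs.image psum).card := Finset.card_le_card hsub
    _ ≤ Pairs.card := Finset.card_image_le
    _ = K * (K + 1) / 2 := hpairs

/-- **WIDTH-TWO ROW, trivial form** `GenValRootLawAt 2 K (K (K + 1) / 2 − 1)` (unfolded): a `2 × 2` pencil determinant
with `K` letters has at most `K (K + 1) / 2 − 1` Newton edges. [sector row; NOT sharp for symmetric letters at
`K = 4`, where the value is `8` = `…TwoFourCalibration`] -/
theorem genValRootLaw_width_two_unfolded (K : ℕ) :
    ∀ (F : Type) [Field F] [CharZero F] (v : AbsoluteValue F ℝ), IsNonarchimedean v →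
      ∀ (d : Fin K → ℕ) (M : Fin K → Matrix (Fin 2) (Fin 2) F),
        ((Matrix.det (∑ l, ((Polynomial.X : Polynomial F) ^ d l) • (M l).map Polynomial.C)).support.filter fun E =>
            ∃ r : ℝ, 0 < r ∧ ∀ E' ∈ (Matrix.det (∑ l, ((Polynomial.X : Polynomial F) ^ d l) • (M l).map Polynomial.C)).support,
              E' ≠ E →
              v ((Matrix.det (∑ l, ((Polynomial.X : Polynomial F) ^ d l) • (M l).map Polynomial.C)).coeff E') * r ^ E'
                < v ((Matrix.det (∑ l, ((Polynomial.X : Polynomial F) ^ d l) • (M l).map Polynomial.C)).coeff E) * r ^ E).card - 1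
          ≤ K * (K + 1) / 2 - 1 := by
  intro F _ _ v _ d M
  set f : F[X] := Matrix.det (∑ l, ((X : F[X]) ^ d l) • (M l).map (C : F →+* F[X])) with hf
  have h := card_filter_dominant_le_card_support v f
  have h1 : f.support.card ≤ K * (K + 1) / 2 := by
    rw [hf]
    exact card_support_det_width_two d M
  omega

end Summit.ValiantsHypothesis.ValiantsHypothesis.Theorems.KPlusLogSqLaw.ValDoor
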